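import Summits.BirchSwinnertonDyer.BirchSwinnertonDyer.Theorems.EisensteinPrimesAcTwistDeformationCurveSUR
import Literature.NumberTheory.IwasawaTheory.Greenberg2016.LocalCohomologyAlmostDivisible
import Literature.NumberTheory.IwasawaTheory.Greenberg2006.LocalH2VanishingOfLOC1
import HarnessLib

/-!
# Greenberg 2016 Prop. 4.1.1 (c) AT THE CURVE DEFORMATION `𝐃_E = E[p^∞] ⊗ Λ^*(κ⁻¹)`, for the `Sf`-IMPRIMITIVE
# specification "strict at `v̄`, no condition elsewhere": `S_{𝓛^{v̄}}(K, 𝐃_E)` is ALMOST `Λ`-DIVISIBLE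
# (cell `bsd-eis`, width seat `bsd-line-x2-p2` gen 7; crux 4 `BSDpOnCellC` stmt-BirchSwinnertonDyer-19034, line b1 v12;
# E-side twin of x1-w3 g2's `bigRep_fullAtSelmer_isAlmostDivisible`, in x1-w3 g3's curve arena `…CurveSUR`)

HONEST FRAMING (cell `bsd-eis`, run/shared/lean/pub/bsd-eis/): bookkeeping on Greenberg's arena; no definition, no
named fact introduced, no `sorry`, no `Theses` import; nothing about BSD or a main conjecture is asserted; nothing
booked; no label or count moves. Helper `--supports stmt-BirchSwinnertonDyer-19034`; closes no stub. CONDITIONAL on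
the PUBLISHED named facts Greenberg 2016 Prop. 4.1.1 (`prop411_selmer_isAlmostDivisible`) and Greenberg 2006 Props.
4.1, 4.2, 3.2 (`prop41_…`, `prop42_…`, `prop32_…`) taken as hypotheses BY NAME; Greenberg 2016 Prop. 4.2.2 and
Greenberg 2006 §5 A are the tree's THEOREMS (`prop422_localCohomology_isAlmostDivisible_holds`,
`sec5A_localH2_subsingleton_of_LOC1_holds`) and are discharged here.

## Why (the one E-level input of the reducible dévissage at `p ‖ N`)

Seat g6 of this line (`…ResidualDevissageNonsplitLambdaIdentityAtNonsplit`, p649247) proved Keller–Yin Thm. 1.4.1's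
λ-relation `λ(𝔛^{Sf}_f) ≤ λ(𝔛^{Sf}_{θsub}) + λ(𝔛^{Sf}_{θquot})` at every non-split multiplicative Eisenstein datum
modulo CGLS22 Prop. 1.2.5 + Cor. 1.2.6, with EQUALITY as soon as Castella's imprimitive dual
`𝔛^{Sf}_f = AcSelmer.XAc E_K p κ v̄ ↑Sf γ` has no `p`-torsion — i.e. no non-zero finite `Λ`-submodule (CGLS22 Cor. 1.4.3;
Keller–Yin §1.4 (e); Pollack–Weston 2011 Prop. A.2 for `M_E`). On Greenberg's side that is Prop. 4.1.1 (c) of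
[Greenberg2016Selmer] for `𝐃_E = bigRep κ ρ₀` and the specification `𝓛^{v̄} = (0 at v̄, ⊤ at every other place of Σ)`,
whose Selmer group descends by Shapiro's lemma EXACTLY onto `Sel^{Sf}_{v̄}(K_∞, E[p^∞])` when `Σ = {v, v̄} ∪ Sf` (no
condition at `v` and at `Sf`, strict at `v̄`, unramified = trivial at the good places; the descent is the sequel
file). THIS FILE is the `K`-side almost-divisibility.

## What

* §1 (generic `ρ`, any specification `L` with `L w = if w = v̄ then ⊥ else ⊤`, stated through a hypothesis `hL` — no
  definition): `mem_selmer_strictAt_iff` (`c ∈ S_L ↔ loc_{v̄} c = 0`), `strictAt_isStable`,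
  `strictAt_isAlmostDivisible` (from `⊤` almost divisible at the finite places `≠ v̄` and `H¹ = 0` at the complex
  ones), `hasCorank_QGlobal_strictAt` (`corank Q_L = corank H¹(K_v̄, 𝐃)`), `isCofinitelyGenerated_QGlobal_strictAt`,
  `isCoreflexive_Q_strictAt_of_ne` (`Q_L(K_v) = 0`).
* §2 (one-variable twist deformation `bigRep κ ρ₀` of a `p`-primary `A` with a rank-`n` Pontryagin dual-basis
  family, `K` imaginary quadratic, `p = v v̄`): `bigRep_leo_crk_strictAt_of_dualBasis` (LEO ∧ CRK(𝐃, 𝓛^{v̄}) ∧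
  `h¹ = n` ∧ `h² = 0` from `corank S_{𝓛^{v̄}} = 0`, by cell `bsd-ssimc`'s corank-`m` squeeze
  `hasCorank_H1_and_H2_zero_of_corank` at `L = 𝓛^{v̄}`), **`bigRep_strictAtSelmer_isAlmostDivisible_of_dualBasis`**
  (Prop. 4.1.1 (c) with `η = v`: LOC_v⁽¹⁾, `Q(K_v) = 0` coreflexive; `𝓛^{v̄}` almost divisible by Prop. 4.2.2 + §5 A at
  the finite places; RFX / cofree / LOC⁽²⁾ from `…CofreeRank`).
* §3 (the curve, `A = E[p^∞] = PrimaryTorsion W.geomPoints p`, `n = 2` by `exists_dualBases_primaryTorsion`, local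
  `h⁰ = 0` / LOC⁽¹⁾ from the `σ`-supply by `localH0_and_LOC1_primaryTorsion`):
  **`primaryTorsion_strictAtSelmer_isAlmostDivisible`** — every Pontryagin dual of `S_{𝓛^{v̄}}(K, 𝐃_E)` has no non-zero
  pseudo-null `Λ`-submodule, GRANTED the four published facts by name and ONE input `corank_Λ S_{𝓛^{v̄}}(K, 𝐃_E) = 0` — which
  the sequel obtains from the `Λ`-cotorsion of `𝔛^{Sf}_f` through the Shapiro descent (x1-w3 g3's
  `hasCorank_fullAtSelmer_zero_of_xAc` is the `∅`/fullAt pattern). The fullAt (`𝓛_v`) twin is NOT repeated here.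

References: [Greenberg2016Selmer] Prop. 4.1.1 (c) (§4.1 p. 15 L21–32), Prop. 4.2.2 (§4.2 p. 20 L4–8), §2.3 p. 7,
§4.3 p. 20 L19–30; [Greenberg2006] Props. 3.2, 4.1, 4.2 (§4 A pp. 367–368), §5 A (p. 373); [Greenberg2010] Lemma 5.2.2;
[CastellaGrossiLeeSkinner2022] Cor. 1.4.3; [KellerYin2024] §1.4 (e) (arXiv:2402.12781v2 TeX L1162–1181);
[PollackWeston2011] App. A Prop. A.2.
-/

set_option autoImplicit false
set_option linter.dupNamespace false -- the summit namespace `…BirchSwinnertonDyer.BirchSwinnertonDyer.Theorems` (Sub = Summit, D-0017) trips it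

noncomputable section

open scoped Classical
open NumberField IsDedekindDomain Field Finset
open Literature.NumberTheory.EllipticCurves Literature.NumberTheory.GaloisRepresentations
  Literature.NumberTheory.IwasawaTheory Literature.NumberTheory.IwasawaTheory.Greenberg2016
  Literature.NumberTheory.IwasawaTheory.Greenberg2006
  Summit.BirchSwinnertonDyer.BirchSwinnertonDyer.Theorems.TwistDeformationCofree
  Summit.BirchSwinnertonDyer.BirchSwinnertonDyer.Theorems.GreenbergFullAtSelmer
  Summit.BirchSwinnertonDyer.BirchSwinnertonDyer.Theorems.SignedBaseChangeAcDivGreenbergSqueeze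

namespace Summit.BirchSwinnertonDyer.BirchSwinnertonDyer.Theorems.AcTwistDeformation

/-! ## §1 The specification "`0` at `v̄`, `⊤` elsewhere" (no definition: any `L` with `hL`) -/

section StrictAt

variable {Λ : Type} [CommRing Λ] {K : Type} [Field K] [NumberField K] {S : Set (HeightOneSpectrum (𝓞 K))}
  [TopologicalSpace Λ] {D : Type} [AddCommGroup D] [Module Λ D] [TopologicalSpace D] [DiscreteTopology D]
  [ContinuousSMul Λ D] {ρ : ContinuousRep (GaloisGroupUnramifiedOutside K S) Λ D}
  {η' : HeightOneSpectrum (𝓞 K)} (L : Specification S ρ)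
  (hL : ∀ w : Place K, L w = if w = Sum.inr η' then ⊥ else ⊤)

include hL

/-- At `v̄` the condition is zero. [cite: Greenberg2016Selmer, §1 p. 3 L19–25 (a specification `𝓛`)] -/
theorem strictAt_self : L (Sum.inr η') = ⊥ := by
  rw [hL, if_pos rfl]

/-- Away from `v̄` the condition is everything. [cite: Greenberg2016Selmer, §1 p. 3 L19–25] -/
theorem strictAt_of_ne {w : Place K} (hw : w ≠ Sum.inr η') : L w = ⊤ := by
  rw [hL, if_neg hw]

/-- Away from `v̄` the local quotient `Q_L(K_w, 𝐃) = H¹(K_w, 𝐃)/H¹(K_w, 𝐃)` is the zero module.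
[cite: Greenberg2016Selmer, §1 p. 3 L23–25] -/
theorem subsingleton_Q_strictAt_of_ne {w : Place K} (hw : w ≠ Sum.inr η') : Subsingleton (L.Q w) :=
  Submodule.Quotient.subsingleton_iff.mpr (strictAt_of_ne L hL hw)

/-- **Membership in `S_{𝓛^{v̄}}(K, 𝐃)`**: a global class lies in the Selmer group of "`0` at `v̄`, `⊤` elsewhere" iff its
localisation at `v̄` VANISHES (`v̄ ∈ Σ`). [cite: Greenberg2016Selmer, §1 p. 3 L26–32] -/
theorem mem_selmer_strictAt_iff (hη' : η' ∈ S) (c : ρ.H 1) :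
    c ∈ L.selmer ↔ loc S ρ (Sum.inr η') 1 c = 0 := by
  rw [Specification.mem_selmer_iff]
  constructor
  · intro h
    have h' := h ⟨Sum.inr η', (inSigma_inr_iff S η').mpr hη'⟩
    rwa [strictAt_self L hL, Submodule.mem_bot] at h'
  · intro h v
    by_cases hv : v.1 = Sum.inr η'
    · rw [hv, strictAt_self L hL, Submodule.mem_bot]
      exact h
    · rw [strictAt_of_ne L hL hv]
      exact Submodule.mem_top

/-- `𝓛^{v̄}` is a specification by `R`-submodules for any bigger coefficient ring (`⊤`, `⊥` are stable).
[cite: Greenberg2016Selmer, §1 p. 3 L19–21] -/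
theorem strictAt_isStable {R : Type} [CommRing R] [Module R D] [SMulCommClass R Λ D]
    (hR : ∀ (g : GaloisGroupUnramifiedOutside K S) (r : R) (d : D), ρ g (r • d) = r • ρ g d) :
    L.IsStable hR := by
  intro v _ r c hc
  by_cases hv : v = Sum.inr η'
  · subst hv
    rw [strictAt_self L hL] at hc ⊢
    rw [(Submodule.mem_bot Λ).mp hc, map_zero]
    exact Submodule.zero_mem _
  · rw [strictAt_of_ne L hL hv]
    exact Submodule.mem_top

/-- **"`𝓛^{v̄}` is almost divisible"** reduces to the finite places of `Σ` other than `v̄`: there it is the full local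
condition `H¹(K_w, 𝐃)` (Prop. 4.2.2's output), at `v̄` it is `0`, at the complex archimedean places `H¹ = 0`.
[cite: Greenberg2016Selmer, §2.5 p. 8 L35–37, Prop. 4.2.2 (§4.2 p. 20 L4–8)] -/
theorem strictAt_isAlmostDivisible
    (hfin : ∀ w : HeightOneSpectrum (𝓞 K), w ∈ S → w ≠ η' →
      Greenberg2016.IsAlmostDivisible Λ (⊤ : Submodule Λ ((localRep S ρ (Sum.inr w)).H 1)))
    (harch : ∀ w : InfinitePlace K, Subsingleton ((localRep S ρ (Sum.inl w)).H 1)) :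
    L.IsAlmostDivisible := by
  rintro (w | w) hw
  · haveI := harch w
    haveI : Subsingleton (L (Sum.inl w)) := inferInstance
    exact Greenberg2016.isAlmostDivisible_of_subsingleton
  · by_cases hwη : w = η'
    · subst hwη
      rw [strictAt_self L hL]
      exact Greenberg2016.isAlmostDivisible_of_subsingleton
    · rw [strictAt_of_ne L hL (fun h ↦ hwη (Sum.inr_injective h))]
      exact hfin w ((inSigma_inr_iff S w).mp hw) hwη

/-- **`corank Q_{𝓛^{v̄}}(K, 𝐃) = corank H¹(K_v̄, 𝐃)`**: `Q = ∏_w Q_w` with `Q_v̄ = H¹(K_v̄, 𝐃)` and `Q_w = 0` elsewhere.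
[cite: Greenberg2016Selmer, §1 p. 3 L23–25, §2.3 p. 7 L7–17] -/
theorem hasCorank_QGlobal_strictAt [IsDomain Λ] (hS : S.Finite) (hη' : η' ∈ S) {m : ℕ}
    (hm : HasCorank Λ ((localRep S ρ (Sum.inr η')).H 1) m) : HasCorank Λ L.QGlobal m := by
  haveI := finite_sigmaPlace (K := K) hS
  haveI : Fintype (SigmaPlace S) := Fintype.ofFinite _
  refine hasCorank_pi_of_isCotorsion (S := fun v : SigmaPlace S ↦ L.Q v.1)
    ⟨Sum.inr η', (inSigma_inr_iff S η').mpr hη'⟩ ?_ ?_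
  · exact hasCorank_of_linearEquiv (Submodule.quotEquivOfEqBot _ (strictAt_self L hL)).symm hm
  · rintro ⟨v, hv⟩ hvη'
    have hne : v ≠ Sum.inr η' := fun h ↦ hvη' (Subtype.ext h)
    haveI := subsingleton_Q_strictAt_of_ne L hL hne
    exact isCotorsion_of_subsingleton

/-- **`Q_{𝓛^{v̄}}(K, 𝐃)` is cofinitely generated** when `H¹(K_v̄, 𝐃)` is. [cite: Greenberg2006, Prop. 3.2 (p. 358), §4 p. 367 L33–39] -/
theorem isCofinitelyGenerated_QGlobal_strictAt (hS : S.Finite)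
    (hcfg : IsCofinitelyGenerated Λ ((localRep S ρ (Sum.inr η')).H 1)) :
    IsCofinitelyGenerated Λ L.QGlobal := by
  haveI := finite_sigmaPlace (K := K) hS
  haveI : Fintype (SigmaPlace S) := Fintype.ofFinite _
  refine isCofinitelyGenerated_pi (T := fun v : SigmaPlace S ↦ L.Q v.1) fun ⟨v, hv⟩ ↦ ?_
  by_cases hvη : v = Sum.inr η'
  · subst hvη
    exact isCofinitelyGenerated_of_linearEquiv (Submodule.quotEquivOfEqBot _ (strictAt_self L hL)).symm hcfg
  · haveI := subsingleton_Q_strictAt_of_ne L hL hvη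
    exact isCofinitelyGenerated_of_subsingleton

/-- Clause (c) of Prop. 4.1.1 for `𝓛^{v̄}` at a place `η ≠ v̄`, coreflexivity half: `Q_{𝓛^{v̄}}(K_η, 𝐃) = 0`.
[cite: Greenberg2016Selmer, Prop. 4.1.1 (c) (§4.1 p. 15 L30–31)] -/
theorem isCoreflexive_Q_strictAt_of_ne {w : Place K} (hw : w ≠ Sum.inr η') : IsCoreflexive Λ (L.Q w) := by
  haveI := subsingleton_Q_strictAt_of_ne L hL hw
  exact Greenberg2016.isCoreflexive_of_subsingleton

end StrictAt

/-! ## §2 The one-variable twist deformation with a rank-`n` dual-basis family: LEO, CRK(𝐃, 𝓛^{v̄}), Prop. 4.1.1 (c) -/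

section DualBasisForm

variable {K : Type} [Field K] [NumberField K] {S : Set (HeightOneSpectrum (𝓞 K))} {p : ℕ} [Fact p.Prime]
  {A : Type} [AddCommGroup A] [Module ℤ_[p] A] [TopologicalSpace A] [DiscreteTopology A]
  [TopologicalSpace (PowerSeries ℤ_[p])] [IsTopologicalRing (PowerSeries ℤ_[p])]
  [IsTopologicalAddGroup (BigRepModule ℤ_[p] p A)]
  [ContinuousSMul (PowerSeries ℤ_[p]) (BigRepModule ℤ_[p] p A)]
  (hS : ∀ v : HeightOneSpectrum (𝓞 K), ((p : ℕ) : 𝓞 K) ∈ v.asIdeal → v ∈ S)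
  (κ : ZpExtension K p) (ρ₀ : ContinuousRep (GaloisGroupUnramifiedOutside K S) ℤ_[p] A) {n : ℕ}

/-- **LEO(`𝐃`) ∧ CRK(`𝐃`, `𝓛^{v̄}`) ∧ `corank H¹(K_Σ/K, 𝐃) = n` ∧ `corank H²(K_Σ/K, 𝐃) = 0`** for the one-variable twist
deformation `𝐃 = bigRep κ ρ₀` of a `p`-primary `A` with a rank-`n` Pontryagin dual-basis family, over a `ℤ_p`-extension of an
IMAGINARY QUADRATIC `K` with `p = v v̄` split, GRANTED Greenberg 2006 Props. 4.1, 4.2, 3.2 by name (§5 A is the tree's theorem),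
local `h⁰ = 0` and LOC⁽¹⁾ at the places of `S`, and `corank_Λ S_{𝓛^{v̄}}(K, 𝐃) = 0` for ANY specification `L = 𝓛^{v̄}` with
`L w = if w = v̄ then ⊥ else ⊤`. The squeeze is cell `bsd-ssimc`'s `hasCorank_H1_and_H2_zero_of_corank` at `L` (`corank Q_L =
corank H¹(K_v̄, 𝐃) = n` by Prop. 4.2 (a) at the degree-one place `v̄`). [cite: Greenberg2006, Props. 4.1–4.2 (§4 A pp. 367–368), Prop. 3.2, §5 A]
[cite: Greenberg2016Selmer, §2.2–2.3 pp. 6–7] -/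
theorem bigRep_leo_crk_strictAt_of_dualBasis (h41 : prop41_globalEulerPoincareCorank)
    (h42 : prop42_localEulerPoincareCorank) (h32 : prop32_cohomology_isCofinitelyGenerated)
    (hSf : S.Finite) (hK : IsImaginaryQuadratic K) (hA : ∀ a : A, ∃ k : ℕ, p ^ k • a = 0)
    (jQ : Fin n → (A →+ AddCircle (1 : ℚ)))
    (hinjQ : ∀ c : Fin n → ℤ_[p], (∀ a : A, ∑ k, jQ k (c k • a) = 0) → c = 0)
    (hsurjQ : ∀ φ : A →+ AddCircle (1 : ℚ), ∃ c : Fin n → ℤ_[p], ∀ a : A, φ a = ∑ k, jQ k (c k • a))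
    (h0loc : ∀ v : HeightOneSpectrum (𝓞 K), v ∈ S →
      HasCorank (PowerSeries ℤ_[p])
        ((localRep S (bigRep (κ.liftUnramifiedOutside S hS) ρ₀) (Sum.inr v)).H 0) 0)
    (hLOC1fin : ∀ v : HeightOneSpectrum (𝓞 K), v ∈ S →
      LOC1 S (bigRep (κ.liftUnramifiedOutside S hS) ρ₀) (Sum.inr v))
    {𝔭 𝔭bar : HeightOneSpectrum (𝓞 K)} (hne : 𝔭bar ≠ 𝔭)
    (hp𝔭 : ((p : ℕ) : 𝓞 K) ∈ 𝔭.asIdeal) (hp𝔭bar : ((p : ℕ) : 𝓞 K) ∈ 𝔭bar.asIdeal)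
    (L : Specification S (bigRep (κ.liftUnramifiedOutside S hS) ρ₀))
    (hL : ∀ w : Place K, L w = if w = Sum.inr 𝔭bar then ⊥ else ⊤)
    (hSel : HasCorank (PowerSeries ℤ_[p]) L.selmer 0) :
    LEO S (bigRep (κ.liftUnramifiedOutside S hS) ρ₀) ∧ L.CRK ∧
      HasCorank (PowerSeries ℤ_[p]) ((bigRep (κ.liftUnramifiedOutside S hS) ρ₀).H 1) n ∧
      HasCorank (PowerSeries ℤ_[p]) ((bigRep (κ.liftUnramifiedOutside S hS) ρ₀).H 2) 0 := by
  have hΛ := nonempty_iwasawaAlgebra_ringEquiv_mvPowerSeries p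
  -- the instance data from the dual basis
  have hcf := isCofinitelyGenerated_bigRepModule_pi hA jQ hinjQ hsurjQ
  have hm := hasCorank_bigRepModule_pi hA jQ hinjQ hsurjQ
  have hpD : ∀ d : BigRepModule ℤ_[p] p A, ∃ n : ℕ, (p ^ n : ℤ) • d = 0 := exists_zpow_smul_eq_zero
  -- `K` imaginary quadratic, `p` split
  haveI := hK.2
  have hKc : ∀ w : InfinitePlace K, w.IsComplex := IsTotallyComplex.isComplex
  have hr₂ := nrComplexPlaces_eq_one_of_isImaginaryQuadratic hK
  have hdeg : 𝔭bar.asIdeal.ramificationIdx ℤ * 𝔭bar.asIdeal.inertiaDeg ℤ = 1 :=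
    (ncard_primesOver_eq_two_and_deg_one_of_ne hK.1 hp𝔭 hp𝔭bar hne).2 hp𝔭bar
  -- cofinite generation everywhere (Prop. 3.2)
  have hcfg : ∀ (v : Place K) (i : ℕ), IsCofinitelyGenerated (PowerSeries ℤ_[p]) ((localRep S (bigRep (κ.liftUnramifiedOutside S hS) ρ₀) v).H i) :=
    fun v i ↦ h32.local hSf hS hΛ (bigRep (κ.liftUnramifiedOutside S hS) ρ₀) hpD hcf v i
  have hSelfg : IsCofinitelyGenerated (PowerSeries ℤ_[p]) L.selmer :=
    isCofinitelyGenerated_submodule (h32.global hSf hS hΛ (bigRep (κ.liftUnramifiedOutside S hS) ρ₀) hpD hcf 1) _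
  -- global `h⁰ = 0` from the local one at `𝔭`
  have h0 : HasCorank (PowerSeries ℤ_[p]) ((bigRep (κ.liftUnramifiedOutside S hS) ρ₀).H 0) 0 :=
    hasCorank_H0_zero_of_local (bigRep (κ.liftUnramifiedOutside S hS) ρ₀) (Sum.inr 𝔭) (hcfg (Sum.inr 𝔭) 0) (h0loc 𝔭 (hS 𝔭 hp𝔭))
  -- local coranks at `v̄`: `h² = 0` (§5 A), `h¹ = n` (Prop. 4.2 (a) at a degree-one place)
  have h2bar : HasCorank (PowerSeries ℤ_[p]) ((localRep S (bigRep (κ.liftUnramifiedOutside S hS) ρ₀) (Sum.inr 𝔭bar)).H 2) 0 :=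
    hasCorank_localH2_zero_of_sec5A (bigRep (κ.liftUnramifiedOutside S hS) ρ₀) sec5A_localH2_subsingleton_of_LOC1_holds hSf hS hΛ hpD hcf
      (hLOC1fin 𝔭bar (hS 𝔭bar hp𝔭bar))
  have h1bar : HasCorank (PowerSeries ℤ_[p]) ((localRep S (bigRep (κ.liftUnramifiedOutside S hS) ρ₀) (Sum.inr 𝔭bar)).H 1) n :=
    hasCorank_localH1_of_prop42_degree_one (bigRep (κ.liftUnramifiedOutside S hS) ρ₀) h42 hSf hS hΛ hpD hcf hp𝔭bar hdeg hm
      (h0loc 𝔭bar (hS 𝔭bar hp𝔭bar)) h2bar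
  -- `Q_L`: corank `n`, cofinitely generated
  have hQ : HasCorank (PowerSeries ℤ_[p]) L.QGlobal n :=
    hasCorank_QGlobal_strictAt L hL hSf (hS 𝔭bar hp𝔭bar) h1bar
  have hQfg : IsCofinitelyGenerated (PowerSeries ℤ_[p]) L.QGlobal :=
    isCofinitelyGenerated_QGlobal_strictAt L hL hSf (hcfg (Sum.inr 𝔭bar) 1)
  -- the squeeze
  obtain ⟨hH1, hH2⟩ := hasCorank_H1_and_H2_zero_of_corank (bigRep (κ.liftUnramifiedOutside S hS) ρ₀) h41 hSf hS hKc hr₂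
    hΛ hpD hcf hm h0 L hSel hSelfg hQ hQfg
  exact ⟨leo_of_hasCorank_H2_zero (bigRep (κ.liftUnramifiedOutside S hS) ρ₀) h32 hSf hS hΛ hpD hcf hH2,
    CRK_of_hasCorank L (s₀ := 0) (q₀ := n) (by simpa using hH1) hSel hQ, hH1, hH2⟩

/-- **Greenberg 2016 Prop. 4.1.1 (c) for `𝓛^{v̄}` at the one-variable twist deformation `𝐃 = bigRep κ ρ₀`** of a
`p`-primary `A` with rank-`n` Pontryagin dual-basis families over `ℚ/ℤ` and over `K̄ˣ` (e.g. `A = E[p^∞]`, `n = 2`), `K`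
imaginary quadratic, `p = v v̄`, `S ⊇ {v, v̄}` finite with local `h⁰ = 0` and LOC⁽¹⁾ at every place of `S` (a `σ`-supply): for
ANY specification `L` with `L w = if w = v̄ then ⊥ else ⊤` and `corank_Λ S_L(K, 𝐃) = 0`, **`S_L(K, 𝐃)` IS ALMOST
`Λ`-DIVISIBLE** (every Pontryagin dual has no non-zero pseudo-null submodule), GRANTED Greenberg 2016 Prop. 4.1.1 and
Greenberg 2006 Props. 4.1, 4.2, 3.2 BY NAME. Discharged here: RFX / cofree / cofinitely generated / `p`-primary
(`…CofreeRank`), LEO and CRK (the squeeze above), LOC⁽²⁾ on `Σ` (`bigRep_LOC2_pi`, `loc2_inl_of_isComplex`), "`𝓛^{v̄}` almost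
divisible" (Prop. 4.2.2 `_holds` + §5 A `_holds` at the finite `w ≠ v̄`, `H¹(ℂ, ·) = 0`), clause (c) at `η = v` (LOC_v⁽¹⁾,
`Q_L(K_v) = 0`). [cite: Greenberg2016Selmer, Prop. 4.1.1 (c) (§4.1 p. 15 L21–32), Prop. 4.2.2 (§4.2 p. 20 L4–8), §4.3 p. 20 L19–30]
[cite: Greenberg2006, Prop. 3.2 p. 358, Props. 4.1–4.2 (§4 A pp. 367–368), §5 A (p. 373)] -/
theorem bigRep_strictAtSelmer_isAlmostDivisible_of_dualBasis (h411 : prop411_selmer_isAlmostDivisible)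
    (h41 : prop41_globalEulerPoincareCorank) (h42 : prop42_localEulerPoincareCorank)
    (h32 : prop32_cohomology_isCofinitelyGenerated)
    (hSf : S.Finite) (hK : IsImaginaryQuadratic K) (hA : ∀ a : A, ∃ k : ℕ, p ^ k • a = 0)
    (jQ : Fin n → (A →+ AddCircle (1 : ℚ)))
    (hinjQ : ∀ c : Fin n → ℤ_[p], (∀ a : A, ∑ k, jQ k (c k • a) = 0) → c = 0)
    (hsurjQ : ∀ φ : A →+ AddCircle (1 : ℚ), ∃ c : Fin n → ℤ_[p], ∀ a : A, φ a = ∑ k, jQ k (c k • a))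
    (jU : Fin n → (A →+ DiscreteGaloisModule.UnitsCarrier K))
    (hinjU : ∀ c : Fin n → ℤ_[p], (∀ a : A, ∑ k, jU k (c k • a) = 0) → c = 0)
    (hsurjU : ∀ φ : A →+ DiscreteGaloisModule.UnitsCarrier K, ∃ c : Fin n → ℤ_[p], ∀ a : A,
      φ a = ∑ k, jU k (c k • a))
    (h0loc : ∀ v : HeightOneSpectrum (𝓞 K), v ∈ S →
      HasCorank (PowerSeries ℤ_[p])
        ((localRep S (bigRep (κ.liftUnramifiedOutside S hS) ρ₀) (Sum.inr v)).H 0) 0)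
    (hLOC1fin : ∀ v : HeightOneSpectrum (𝓞 K), v ∈ S →
      LOC1 S (bigRep (κ.liftUnramifiedOutside S hS) ρ₀) (Sum.inr v))
    {𝔭 𝔭bar : HeightOneSpectrum (𝓞 K)} (hne : 𝔭bar ≠ 𝔭)
    (hp𝔭 : ((p : ℕ) : 𝓞 K) ∈ 𝔭.asIdeal) (hp𝔭bar : ((p : ℕ) : 𝓞 K) ∈ 𝔭bar.asIdeal)
    (L : Specification S (bigRep (κ.liftUnramifiedOutside S hS) ρ₀))
    (hL : ∀ w : Place K, L w = if w = Sum.inr 𝔭bar then ⊥ else ⊤)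
    (hSel : HasCorank (PowerSeries ℤ_[p]) L.selmer 0) :
    IsAlmostDivisible (PowerSeries ℤ_[p]) L.selmer := by
  -- standing clauses of the arena at `Λ = R = ℤ_p⟦T⟧`
  have hΛ := nonempty_iwasawaAlgebra_ringEquiv_mvPowerSeries p
  have hcpl := isAdicComplete_maximalIdeal_iwasawaAlgebra p
  have hres := finite_residueField_iwasawaAlgebra p
  have hchar := charP_residueField_iwasawaAlgebra p
  have hinjΛ : Function.Injective (algebraMap (PowerSeries ℤ_[p]) (PowerSeries ℤ_[p])) :=
    fun a b h ↦ by simpa using h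
  have hfin : Module.Finite (PowerSeries ℤ_[p]) (PowerSeries ℤ_[p]) := inferInstance
  have hlin : ∀ (g : GaloisGroupUnramifiedOutside K S) (r : PowerSeries ℤ_[p]) (d : BigRepModule ℤ_[p] p A),
      bigRep (κ.liftUnramifiedOutside S hS) ρ₀ g (r • d) = r • bigRep (κ.liftUnramifiedOutside S hS) ρ₀ g d :=
    fun g r d ↦ map_smul (bigRep (κ.liftUnramifiedOutside S hS) ρ₀ g) r d
  -- the instance data from the dual bases
  have hT := isCofree_bigRepModule_pi hA jQ hinjQ hsurjQ
  have hcf := isCofinitelyGenerated_bigRepModule_pi hA jQ hinjQ hsurjQ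
  have hRFX := rfx_bigRepModule_pi hA jQ hinjQ hsurjQ
  have hpD : ∀ d : BigRepModule ℤ_[p] p A, ∃ n : ℕ, (p ^ n : ℤ) • d = 0 := exists_zpow_smul_eq_zero
  haveI := hK.2
  have hKc : ∀ w : InfinitePlace K, w.IsComplex := IsTotallyComplex.isComplex
  -- LEO and CRK by the squeeze
  obtain ⟨hLEO, hCRK, -, -⟩ := bigRep_leo_crk_strictAt_of_dualBasis hS κ ρ₀ h41 h42 h32 hSf hK hA jQ hinjQ hsurjQ
    h0loc hLOC1fin hne hp𝔭 hp𝔭bar L hL hSel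
  -- LOC⁽²⁾ on all of `Σ`
  have hLOC2 : ∀ v : Place K, InSigma S v → LOC2 S (bigRep (κ.liftUnramifiedOutside S hS) ρ₀) v := by
    rintro (w | v) hv
    · exact loc2_inl_of_isComplex S (bigRep (κ.liftUnramifiedOutside S hS) ρ₀) w (hKc w)
    · exact bigRep_LOC2_pi S hS κ ρ₀ hA jU hinjU hsurjU (Sum.inr v) (hLOC1fin v ((inSigma_inr_iff S v).mp hv))
  -- "`𝓛^{v̄}` almost divisible": Prop. 4.2.2 + §5 A at the finite places, `H¹(ℂ, ·) = 0` at the archimedean ones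
  have hLad : L.IsAlmostDivisible :=
    strictAt_isAlmostDivisible L hL
      (fun w hw _ ↦ top_isAlmostDivisible_of_facts prop422_localCohomology_isAlmostDivisible_holds
        sec5A_localH2_subsingleton_of_LOC1_holds hSf hS hΛ hinjΛ hfin hcpl hres hchar hlin hT hcf hpD hRFX hw
        (hLOC1fin w hw))
      (fun w ↦ subsingleton_localH1_inl_of_isComplex S (bigRep (κ.liftUnramifiedOutside S hS) ρ₀) (hKc w))
  -- Prop. 4.1.1 (c) at `η = 𝔭`
  exact h411 p K S hSf hS (PowerSeries ℤ_[p]) 1 hΛ (PowerSeries ℤ_[p]) hinjΛ hfin hcpl hres hchar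
    (BigRepModule ℤ_[p] p A) (bigRep (κ.liftUnramifiedOutside S hS) ρ₀) hlin hT hpD L (strictAt_isStable L hL hlin) hRFX hLEO hLOC2
    ⟨𝔭, hS 𝔭 hp𝔭, hLOC1fin 𝔭 (hS 𝔭 hp𝔭)⟩ hLad hCRK
    (Or.inr (Or.inr ⟨𝔭, hS 𝔭 hp𝔭, hLOC1fin 𝔭 (hS 𝔭 hp𝔭),
      isCoreflexive_Q_strictAt_of_ne L hL (fun h ↦ hne.symm (Sum.inr_injective h))⟩))

end DualBasisForm

/-! ## §3 The curve: `A = E[p^∞]`, `n = 2` -/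

section Curve

variable {K : Type} [Field K] [NumberField K] {S : Set (HeightOneSpectrum (𝓞 K))} {p : ℕ} [Fact p.Prime]
  (W : WeierstrassCurve K) [W.IsElliptic]
  [TopologicalSpace (PowerSeries ℤ_[p])] [IsTopologicalRing (PowerSeries ℤ_[p])]
  [IsTopologicalAddGroup (BigRepModule ℤ_[p] p (PrimaryTorsion W.geomPoints p))]
  [ContinuousSMul (PowerSeries ℤ_[p]) (BigRepModule ℤ_[p] p (PrimaryTorsion W.geomPoints p))]
  (hS : ∀ v : HeightOneSpectrum (𝓞 K), ((p : ℕ) : 𝓞 K) ∈ v.asIdeal → v ∈ S)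
  (κ : ZpExtension K p)
  (ρ₀ : ContinuousRep (GaloisGroupUnramifiedOutside K S) ℤ_[p] (PrimaryTorsion W.geomPoints p))

/-- **`S_{𝓛^{v̄}}(K, 𝐃_E)` IS ALMOST `Λ`-DIVISIBLE** — Greenberg 2016 Prop. 4.1.1 (c) for `𝐃_E = E[p^∞] ⊗ Λ^*(κ⁻¹)` and the
`Sf`-imprimitive specification "`0` at `v̄`, `⊤` at every other place of `Σ`": for an elliptic `W/K`, `K` imaginary quadratic,
`p = v v̄`, `S ⊇ {w ∣ p}` finite with a `σ`-supply (no place of `S` splits completely in `K_∞`), ANY continuous `ℤ_p`-linear `ρ₀`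
of `G_{K,S}` on `E[p^∞]`, and ANY `L` with `L w = if w = v̄ then ⊥ else ⊤`: every Pontryagin dual of `S_L(K, 𝐃_E)` has no
non-zero pseudo-null (`=` finite, `Λ = ℤ_p⟦T⟧`) submodule, GRANTED Greenberg 2016 Prop. 4.1.1 and Greenberg 2006 Props. 4.1,
4.2, 3.2 BY NAME and `corank_Λ S_L(K, 𝐃_E) = 0`. The `K`-side of «`𝔛^{Sf}_f` has no non-zero finite `Λ`-submodule»
(CGLS22 Cor. 1.4.3 / Keller–Yin §1.4 (e)) at `Σ = {v, v̄} ∪ Sf`. [cite: Greenberg2016Selmer, Prop. 4.1.1 (c) (§4.1 p. 15 L21–32), §4.3 pp. 20–21]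
[cite: Greenberg2006, Props. 3.2, 4.1, 4.2, §5 A] [cite: CastellaGrossiLeeSkinner2022, Cor. 1.4.3]
[cite: KellerYin2024, §1.4 (e) (arXiv:2402.12781v2 TeX L1162–1181)] [cite: PollackWeston2011, App. A Prop. A.2] -/
theorem primaryTorsion_strictAtSelmer_isAlmostDivisible (h411 : prop411_selmer_isAlmostDivisible)
    (h41 : prop41_globalEulerPoincareCorank) (h42 : prop42_localEulerPoincareCorank)
    (h32 : prop32_cohomology_isCofinitelyGenerated)
    (hSf : S.Finite) (hK : IsImaginaryQuadratic K)
    (hsup : ∀ v : HeightOneSpectrum (𝓞 K), v ∈ S →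
      ∃ σ : absoluteGaloisGroup (Place.Completion (Sum.inr v : Place K)),
        κ (absGaloisRestrict K _ σ) ≠ 1)
    {𝔭 𝔭bar : HeightOneSpectrum (𝓞 K)} (hne : 𝔭bar ≠ 𝔭)
    (hp𝔭 : ((p : ℕ) : 𝓞 K) ∈ 𝔭.asIdeal) (hp𝔭bar : ((p : ℕ) : 𝓞 K) ∈ 𝔭bar.asIdeal)
    (L : Specification S (bigRep (κ.liftUnramifiedOutside S hS) ρ₀))
    (hL : ∀ w : Place K, L w = if w = Sum.inr 𝔭bar then ⊥ else ⊤)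
    (hSel : HasCorank (PowerSeries ℤ_[p]) L.selmer 0) :
    IsAlmostDivisible (PowerSeries ℤ_[p]) L.selmer := by
  obtain ⟨hA, jQ, jU, hinjQ, hsurjQ, hinjU, hsurjU⟩ := exists_dualBases_primaryTorsion W p
  have hloc := fun v (hv : v ∈ S) ↦
    localH0_and_LOC1_primaryTorsion S W hS κ ρ₀ (Sum.inr v) (hsup v hv).choose (hsup v hv).choose_spec
  exact bigRep_strictAtSelmer_isAlmostDivisible_of_dualBasis hS κ ρ₀ h411 h41 h42 h32 hSf hK hA jQ hinjQ hsurjQ jU hinjU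
    hsurjU (fun v hv ↦ (hloc v hv).1) (fun v hv ↦ (hloc v hv).2) hne hp𝔭 hp𝔭bar L hL hSel

end Curve

end Summit.BirchSwinnertonDyer.BirchSwinnertonDyer.Theorems.AcTwistDeformation

end
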